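import Summits.NavierStokesRegularity.FluidComputer.GateBudgetRelight
import HarnessLib

/-!
# What no tuning can beat, part 60: THE RELIGHT LAW (law 4″ of the θ-drift audit, assembled) —
# after a dousing at clock `-θε` (`1 ≤ θ ≤ 3/2`) with output pair `P₀ ≤ 1/50` and trigger
# `(ρ²/K⁹)e^{-L} ≤ c(T) ≤ 2ρ²/K¹⁰`, the trigger of a headline member stays `≤ ρ²/K⁹` until a
# relight time `r ∈ (tz, T + 3)` at which `c(r) = ρ²/K⁹`, where `tz ∈ T + [θ/s_u, θ/s_l]` is the
# clock zero, and `r` is pinned TWO-SIDEDLY — below by `r > T + 2θ/s_u ∨ s_u(r - tz)²/2 >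
# 1 - 10 log K/K¹⁰`, above by `r ≤ T + 2θ/s_l + L/(K¹⁰θ)` and `s_l(r - tz)²/2 < 1` — with the
# relight clock `εs_l(r - tz) ≤ b(r) ≤ εs_u(r - tz)` (`s_l = 1 - P₀ - 8/K⁹`, `s_u = 1 - P₀ + 6/K⁹`)

Cell `pub-fluidc`, blueprint seat bp1 (gen 35, third item); same namespace and conventions as
parts 1–59 (`GateBudget*.lean`); imports part 59 (`GateBudgetRelight`: §180 `relight_numerics`,
§181 `knob_cold_debt_relight`, §182 `knob_cold_seed`; hence part 58 §174–§179 and part 57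
§172). Headline knob family `rotorCircuit K K¹⁰ ε ρ` (`σ = ρ²e^{-K¹⁰}`, `μ = ε⁻¹K¹⁰`; modes
`0 = a` carrier, `1 = b` clock, `2 = c` trigger, `3 = d`, `4 = ã`). HONEST FRAMING (verbatim):
low prior, high value-of-information experiment on Tao's machine paradigm; NOT a claim that NS
blows up. Nothing is proved about the Navier–Stokes equations.

## Why (SPEC-INPUT-bp1 §AZ/§BA/§BB)

The misfire ladder iterates "dousing at clock `-θₙε` → cold phase → relight at clock `θₙ₊₁ε`";
the θ-ledger (law 5″) needs the relight clock `θₙ₊₁ε = b(r)` two-sidedly with errors `O(1/K⁹)`,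
`O(L/(K¹⁰θ))` (`L ≤ 485K` on the ladder) and `O(log K/K¹⁰)`, all summable over `≤ 10⁻⁴K⁸`
rungs. Parts 57–59 proved every ingredient on an ABSTRACT window `[T, u]` on which `c ≤ ρ²/K⁹`;
this file produces the window and assembles:
* the relight time `r` is the first return of `c` to `ρ²/K⁹` after `T` within three time units
  (`Thm53.exists_hitTime` on `s ↦ c(T + s)`), so `c ≤ ρ²/K⁹` on `[T, r]` and `c(r) = ρ²/K⁹`
  unless `r = T + 3`;
* the clock at `r` is positive (§184): otherwise part 58 §178 keeps `c(r) ≤ c(T) + 3σ < ρ²/K⁹`,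
  so `r = T + 3`, where part 57's lower clock bracket `-θε + 3εs_l > 0` already; hence the
  clock zero `tz ∈ (T, r)` exists (intermediate value theorem) and part 57's brackets at `tz`
  place it in `T + [θ/s_u, θ/s_l]`, in particular `tz ≥ T + K⁻⁵`;
* part 59 §182 gives `s_l(r - tz)²/2 < 1`; were `r = T + 3`, `r - tz ≥ 3 - θ/s_l` and
  `s_l(r - tz) ≥ 3s_l - θ ≥ 1.4143` would give `s_l(r - tz)²/2 ≥ (3s_l - θ)²/(2s_l) ≥ 1`
  (§183); so `r < T + 3` and `c(r) = ρ²/K⁹`;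
* part 59 §181 is the debt upper bound; the lower bound (§185): if both `r ≤ T + 2θ/s_u` and
  `s_u(r - tz)²/2 ≤ 1 - 10 log K/K¹⁰`, then `B(r) ≤ B(T)` by part 58 §176's upper parabola and
  part 58 §179 gives `c(r) ≤ c(T) + 3ρ²/K¹⁰ ≤ 5ρ²/K¹⁰ < ρ²/K⁹ = c(r)`;
* the clock at `r` is part 58 §177.

## What is proved

* §183 `cold_zero_location`, `seed_forces_hit` — the two pieces of real arithmetic above.
* §184 `knob_relight_zero` — on a window `[T, r]` (`T < r ≤ T + 3`, `c ≤ ρ²/K⁹`, `c(r) = ρ²/K⁹`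
  unless `r = T + 3`) after a dousing with `1 ≤ θ ≤ 3/2`, `P₀ ≤ 1/50`, `c(T) ≤ 2ρ²/K¹⁰`:
  `b(r) > 0` and the clock zero `tz ∈ [T + θ/s_u, T + θ/s_l]`, `tz < r`, `tz ≥ T + K⁻⁵`.
* §185 `knob_relight_lower` — on such a window with a clock zero `tz` and `c(r) = ρ²/K⁹`:
  `r > T + 2θ/s_u ∨ s_u(r - tz)²/2 > 1 - 10 log K/K¹⁰`.
* §186 `knob_relight` — THE RELIGHT LAW of the header.

Consequence for the θ-ledger (law 5″, SPEC-INPUT-bp1 §BB; not formalised here): `θ⁺ = b(r)/ε`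
obeys `θ⁺ ≤ max(θ(2s_u/s_l - 1) + s_uL/(K¹⁰θ), s_u√(2/s_l))`-type upper bounds and
`θ⁺ ≥ min(θ(2s_l/s_u - 1), s_l√((2/s_u)(1 - 10 log K/K¹⁰)))`-type lower bounds branch by
branch, i.e. a per-rung drift `O(10³/K⁹)`.
-/

noncomputable section

namespace Summit.NavierStokesRegularity.FluidComputer.GateBudget

open Real Set
open Literature.Analysis.FluidPDE.Tao2016AveragedNS

variable {K ε ρ : ℝ} {X : ℝ → Fin 5 → ℝ}

/-! ## §183 Two pieces of real arithmetic -/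

/-- §183 LOCATING A CLOCK ZERO from the brackets `-θε + εs·x ≶ 0` (`ε, s > 0`).
[derived: this file §183] -/
theorem cold_zero_location {s θ x : ℝ} (hε : 0 < ε) (hs : 0 < s) :
    (0 ≤ -(θ * ε) + ε * s * x → θ / s ≤ x) ∧ (-(θ * ε) + ε * s * x ≤ 0 → x ≤ θ / s) := by
  constructor
  · intro h
    rw [div_le_iff₀ hs]
    by_contra hlt
    linarith only [mul_lt_mul_of_pos_left (not_le.1 hlt) hε, h]
  · intro h
    rw [le_div_iff₀ hs]
    by_contra hlt
    linarith only [mul_lt_mul_of_pos_left (not_le.1 hlt) hε, h]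

/-- §183 THE SEED FORCES A HIT BEFORE `T + 3`: if `0.97999 ≤ s_l ≤ 1`, `θ ≤ 3/2` and
`x ≥ 3 - θ/s_l` then `s_l x²/2 ≥ 1` (as `s_l x ≥ 3s_l - θ ≥ 1.4143`). [derived: this file §183] -/
theorem seed_forces_hit {sl θ x : ℝ} (hsl1 : 97999 / 100000 ≤ sl) (hsl2 : sl ≤ 1)
    (hθ2 : θ ≤ 3 / 2) (hx : 3 - θ / sl ≤ x) : 1 ≤ sl * x ^ 2 / 2 := by
  have hsl : 0 < sl := by linarith only [hsl1]
  have h2 : sl * (3 - θ / sl) = 3 * sl - θ := by rw [mul_sub, mul_div_cancel₀ _ hsl.ne']; ring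
  have h3 : 14143 / 10000 ≤ sl * x := by
    have := mul_le_mul_of_nonneg_left hx hsl.le
    linarith only [this, h2, hsl1, hθ2]
  have h5 : 2 ≤ (sl * x) ^ 2 := by nlinarith only [h3]
  by_contra hlt
  have h6 : sl * (sl * x ^ 2 / 2) < sl * 1 := mul_lt_mul_of_pos_left (not_le.1 hlt) hsl
  nlinarith only [h5, h6, hsl2]

/-! ## §184 The relight clock is positive; the clock zero -/

/-- §184 THE CLOCK AT THE RELIGHT TIME IS POSITIVE, AND THE CLOCK ZERO: a headline member doused
at `T ≥ 0` (`b(T) = -θε`, `1 ≤ θ ≤ 3/2`, `P₀ = d(T)² + ã(T)² ≤ 1/50`, `c(T) ≤ 2ρ²/K¹⁰`) with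
`c ≤ ρ²/K⁹` on `[T, r]` (`T < r ≤ T + 3`) and `c(r) = ρ²/K⁹` unless `r = T + 3` has `b(r) > 0`
(part 58 §178: while `b ≤ 0`, `c ≤ c(T) + 3σ < ρ²/K⁹`; at `r = T + 3` part 57's lower clock
bracket is positive) and a clock zero `tz < r` with `T + θ/s_u ≤ tz ≤ T + θ/s_l` (IVT and
part 57's brackets), `tz ≥ T + K⁻⁵`. [derived: this file §184] -/
theorem knob_relight_zero
    (hX : ∀ t, HasDerivAt X (RotorKnob.rotorCircuit K (K ^ 10) ε ρ (X t)) t)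
    (h0 : X 0 = delayInit) (hK : 16 ≤ K) (hε : 0 < ε) (hεK : ε ^ 2 ≤ 1 / (6 * K ^ 20))
    (hρ : 0 < ρ) (hhi : K ^ 10 * ρ ^ 2 ≤ 2 * ε) {T r θ P₀ : ℝ} (hT : 0 ≤ T)
    (hr : r ≤ T + 3) (hTr : T < r) (hθ1 : 1 ≤ θ) (hθ2 : θ ≤ 3 / 2)
    (hbT : X T 1 = -(θ * ε)) (hP : X T 3 ^ 2 + X T 4 ^ 2 = P₀)
    (hc : ∀ t ∈ Icc T r, X t 2 ≤ ρ ^ 2 / K ^ 9) (hP0 : P₀ ≤ 1 / 50)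
    (hcT : X T 2 ≤ 2 * ρ ^ 2 / K ^ 10) (hhit : r < T + 3 → X r 2 = ρ ^ 2 / K ^ 9) :
    0 < X r 1 ∧ ∃ tz : ℝ, (T + θ / (1 - P₀ + 6 / K ^ 9) ≤ tz ∧
      tz ≤ T + θ / (1 - P₀ - 8 / K ^ 9) ∧ X tz 1 = 0) ∧ tz < r ∧ T + (K ^ 5)⁻¹ ≤ tz := by
  have hK0 : (0 : ℝ) < K := by linarith
  have hP2 : P₀ ≤ 1 / 2 := by linarith
  obtain ⟨h8, h60, h6, hsl⟩ := cold_slopes hK hP2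
  obtain ⟨n1, -, hw5, -⟩ := relight_numerics hK hρ
  have hP00 : 0 ≤ P₀ := by rw [← hP]; positivity
  have hθ : 0 < θ := by linarith
  obtain ⟨sl, hsl_def⟩ : ∃ sl : ℝ, sl = 1 - P₀ - 8 / K ^ 9 := ⟨_, rfl⟩
  obtain ⟨su, hsu_def⟩ : ∃ su : ℝ, su = 1 - P₀ + 6 / K ^ 9 := ⟨_, rfl⟩
  rw [← hsl_def] at hsl
  have hsu : 0 < su := by rw [hsu_def]; linarith only [hP2, h60]
  have hsl1 : 97999 / 100000 ≤ sl := by rw [hsl_def]; linarith only [hP0, h8]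
  have hsu2 : su ≤ 10001 / 10000 := by rw [hsu_def]; linarith only [hP00, h6]
  simp only [← hsl_def, ← hsu_def]
  have hXf := hX
  rw [RotorKnob.rotorCircuit_eq_fiveGate] at hXf
  obtain ⟨B, hB⟩ := exists_clock_action hXf
  have hrI : r ∈ Icc T r := right_mem_Icc.2 hTr.le
  have hbr := fun t (ht : t ∈ Icc T r) =>
    (knob_cold_brackets hX h0 hK hε hεK hρ hhi hT hr hθ.le hθ2 hbT hP hc ht).2.2
  simp only [← hsl_def, ← hsu_def] at hbr
  -- the clock at `r` is positive
  have hbr0 : 0 < X r 1 := by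
    by_contra hle
    have hle := not_lt.1 hle
    have hq1 := knob_cold_quiet hX h0 hK hε hεK hρ hhi hT hr hθ.le hθ2 hbT hP hc hP2 hB hrI hle
    rcases lt_or_ge r (T + 3) with h3 | h3
    · linarith only [hhit h3, hq1, n1, hcT]
    · have h := (hbr r hrI).1
      have e : r - T = 3 := by linarith only [h3, hr]
      rw [e] at h
      have : 0 < 3 * sl - θ := by linarith only [hsl1, hθ2]
      linarith only [mul_pos hε this, h, hle]
  refine ⟨hbr0, ?_⟩
  -- the clock zero (intermediate value theorem), located by part 57's clock brackets
  have hbT0 : X T 1 < 0 := by rw [hbT]; exact neg_neg_of_pos (mul_pos hθ hε)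
  obtain ⟨tz, htzI, hz⟩ := intermediate_value_Icc hTr.le (continuous_traj hXf 1).continuousOn
    (show (0 : ℝ) ∈ Icc (X T 1) (X r 1) from ⟨hbT0.le, hbr0.le⟩)
  have hz' : X tz 1 = 0 := by simpa using hz
  have htz_lt : tz < r :=
    lt_of_le_of_ne htzI.2 fun h => by rw [h] at hz'; linarith only [hz', hbr0]
  have hloc := hbr tz htzI
  rw [hz'] at hloc
  have htz1 := (cold_zero_location hε hsu).1 hloc.2
  have htz2 := (cold_zero_location hε hsl).2 hloc.1
  have hTw : (K ^ 5)⁻¹ ≤ θ / su := by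
    rw [le_div_iff₀ hsu]
    linarith only [mul_le_mul hw5 hsu2 hsu.le (by norm_num : (0 : ℝ) ≤ 1 / 1048576), hθ1]
  exact ⟨tz, ⟨by linarith only [htz1], by linarith only [htz2], hz'⟩, htz_lt,
    by linarith only [hTw, htz1]⟩

/-! ## §185 The lower bound on the relight time -/

/-- §185 NO RELIGHT WHILE THE DEBT IS UNPAID AND THE SEED UNRIPE: on a window `[T, r]`
(`r ≤ T + 3`, `c ≤ ρ²/K⁹`) after a dousing (`b(T) = -θε`, `0 ≤ θ ≤ 3/2`, `P₀ ≤ 1/2`,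
`c(T) ≤ 2ρ²/K¹⁰`) with a clock zero `tz ∈ [T, r]` and `c(r) = ρ²/K⁹`:
`r > T + 2θ/s_u ∨ s_u(r - tz)²/2 > 1 - 10 log K/K¹⁰` (else part 58 §176 gives `B(r) ≤ B(T)` and
§179 gives `c(r) ≤ c(T) + 3ρ²/K¹⁰ < ρ²/K⁹`). [derived: this file §185] -/
theorem knob_relight_lower
    (hX : ∀ t, HasDerivAt X (RotorKnob.rotorCircuit K (K ^ 10) ε ρ (X t)) t)
    (h0 : X 0 = delayInit) (hK : 16 ≤ K) (hε : 0 < ε) (hεK : ε ^ 2 ≤ 1 / (6 * K ^ 20))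
    (hρ : 0 < ρ) (hhi : K ^ 10 * ρ ^ 2 ≤ 2 * ε) {T r θ P₀ : ℝ} (hT : 0 ≤ T)
    (hr : r ≤ T + 3) (hθ : 0 ≤ θ) (hθ2 : θ ≤ 3 / 2) (hbT : X T 1 = -(θ * ε))
    (hP : X T 3 ^ 2 + X T 4 ^ 2 = P₀) (hc : ∀ t ∈ Icc T r, X t 2 ≤ ρ ^ 2 / K ^ 9)
    (hP0 : P₀ ≤ 1 / 2) (hcT : X T 2 ≤ 2 * ρ ^ 2 / K ^ 10) {tz : ℝ} (htz : tz ∈ Icc T r)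
    (hz : X tz 1 = 0) (hcr : X r 2 = ρ ^ 2 / K ^ 9) :
    T + 2 * θ / (1 - P₀ + 6 / K ^ 9) < r ∨
      1 - 10 * log K / K ^ 10 < (1 - P₀ + 6 / K ^ 9) * (r - tz) ^ 2 / 2 := by
  have hK0 : (0 : ℝ) < K := by linarith
  obtain ⟨-, h60, -, -⟩ := cold_slopes hK hP0
  obtain ⟨-, n2, -, -⟩ := relight_numerics hK hρ
  have hsu : 0 < 1 - P₀ + 6 / K ^ 9 := by linarith only [hP0, h60]
  have hTr : T ≤ r := htz.1.trans htz.2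
  have hrI : r ∈ Icc T r := right_mem_Icc.2 hTr
  have hXf := hX
  rw [RotorKnob.rotorCircuit_eq_fiveGate] at hXf
  obtain ⟨B, hB⟩ := exists_clock_action hXf
  by_contra hnot
  obtain ⟨h1, h2⟩ := not_or.1 hnot
  have h1 := not_lt.1 h1
  have h2 := not_lt.1 h2
  have hact := (knob_cold_action hX h0 hK hε hεK hρ hhi hT hr hθ hθ2 hbT hP hc hB hrI).2
  have hx : (r - T) * (1 - P₀ + 6 / K ^ 9) ≤ 2 * θ :=
    (le_div_iff₀ hsu).1 (by linarith only [h1])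
  have hnn : 0 ≤ (r - T) * (θ - (1 - P₀ + 6 / K ^ 9) * (r - T) / 2) :=
    mul_nonneg (by linarith only [hTr]) (by linarith only [hx])
  have hBr : B r ≤ B T := by linarith only [hact, mul_nonneg hε.le hnn]
  have hq2 := knob_cold_quiet_seed hX h0 hK hε hεK hρ hhi hT hr hθ hθ2 hbT hP hc hP0 hB htz hz
    hrI hBr h2
  linarith only [hq2, hcr, n2, hcT]

/-! ## §186 The relight law (law 4″ of the θ-drift audit) -/

/-- §186 THE RELIGHT LAW (law 4″): a headline member (`rotorCircuit K K¹⁰ ε ρ` from `delayInit`,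
`K ≥ 16`, `0 < ε`, `ε² ≤ 1/(6K²⁰)`, `0 < ρ`, `K¹⁰ρ² ≤ 2ε`) doused at time `T ≥ 0` — clock
`b(T) = -θε` with `1 ≤ θ ≤ 3/2`, output pair `P₀ = d(T)² + ã(T)² ≤ 1/50`, trigger
`(ρ²/K⁹)e^{-L} ≤ c(T) ≤ 2ρ²/K¹⁰` (`L ≥ 0`) — has a clock zero `tz ∈ T + [θ/s_u, θ/s_l]` and a
relight time `r ∈ (tz, T + 3)` with `c ≤ ρ²/K⁹` on `[T, r]`, `c(r) = ρ²/K⁹`,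
LOWER `r > T + 2θ/s_u ∨ s_u(r - tz)²/2 > 1 - 10 log K/K¹⁰`, UPPER `r ≤ T + 2θ/s_l + L/(K¹⁰θ)`
and `s_l(r - tz)²/2 < 1`, and relight clock `εs_l(r - tz) ≤ b(r) ≤ εs_u(r - tz)`
(`s_l = 1 - P₀ - 8/K⁹`, `s_u = 1 - P₀ + 6/K⁹`). [derived: this file §186] -/
theorem knob_relight
    (hX : ∀ t, HasDerivAt X (RotorKnob.rotorCircuit K (K ^ 10) ε ρ (X t)) t)
    (h0 : X 0 = delayInit) (hK : 16 ≤ K) (hε : 0 < ε) (hεK : ε ^ 2 ≤ 1 / (6 * K ^ 20))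
    (hρ : 0 < ρ) (hhi : K ^ 10 * ρ ^ 2 ≤ 2 * ε) {T θ P₀ L : ℝ} (hT : 0 ≤ T)
    (hθ1 : 1 ≤ θ) (hθ2 : θ ≤ 3 / 2) (hbT : X T 1 = -(θ * ε))
    (hP : X T 3 ^ 2 + X T 4 ^ 2 = P₀) (hP0 : P₀ ≤ 1 / 50)
    (hcT : X T 2 ≤ 2 * ρ ^ 2 / K ^ 10) (hL : 0 ≤ L) (hℓ : ρ ^ 2 / K ^ 9 * exp (-L) ≤ X T 2) :
    ∃ tz r : ℝ,
      (T + θ / (1 - P₀ + 6 / K ^ 9) ≤ tz ∧ tz ≤ T + θ / (1 - P₀ - 8 / K ^ 9) ∧ X tz 1 = 0) ∧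
      (tz < r ∧ r < T + 3) ∧ (∀ t ∈ Icc T r, X t 2 ≤ ρ ^ 2 / K ^ 9) ∧
      X r 2 = ρ ^ 2 / K ^ 9 ∧
      (T + 2 * θ / (1 - P₀ + 6 / K ^ 9) < r ∨
        1 - 10 * log K / K ^ 10 < (1 - P₀ + 6 / K ^ 9) * (r - tz) ^ 2 / 2) ∧
      (r ≤ T + 2 * θ / (1 - P₀ - 8 / K ^ 9) + L / (K ^ 10 * θ) ∧
        (1 - P₀ - 8 / K ^ 9) * (r - tz) ^ 2 / 2 < 1) ∧
      (ε * (1 - P₀ - 8 / K ^ 9) * (r - tz) ≤ X r 1 ∧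
        X r 1 ≤ ε * (1 - P₀ + 6 / K ^ 9) * (r - tz)) := by
  have hK0 : (0 : ℝ) < K := by linarith
  have hP2 : P₀ ≤ 1 / 2 := by linarith
  obtain ⟨h8, -, -, -⟩ := cold_slopes hK hP2
  obtain ⟨-, n2, -, -⟩ := relight_numerics hK hρ
  have hP00 : 0 ≤ P₀ := by rw [← hP]; positivity
  have h89 : (0 : ℝ) ≤ 8 / K ^ 9 := by positivity
  have hθ : 0 < θ := by linarith
  have hsl1 : 97999 / 100000 ≤ 1 - P₀ - 8 / K ^ 9 := by linarith only [hP0, h8]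
  have hsl2 : 1 - P₀ - 8 / K ^ 9 ≤ 1 := by linarith only [hP00, h89]
  have hγ : X T 2 < ρ ^ 2 / K ^ 9 := by
    have : (0 : ℝ) ≤ 3 * ρ ^ 2 / K ^ 10 := by positivity
    linarith only [hcT, n2, this]
  have hXf := hX
  rw [RotorKnob.rotorCircuit_eq_fiveGate] at hXf
  -- the relight time: the first return of `c` to `ρ²/K⁹` after `T`, within three time units
  obtain ⟨τ, hτ0, hτ3, hwin, hhit⟩ := Thm53.exists_hitTime (u := fun s => X (T + s) 2)
    ((continuous_traj hXf 2).comp (continuous_const.add continuous_id)) (T := 3)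
    (θ := ρ ^ 2 / K ^ 9) (by norm_num) (by simpa using hγ)
  obtain ⟨r, hr_def⟩ : ∃ r : ℝ, r = T + τ := ⟨_, rfl⟩
  have hTr : T < r := by rw [hr_def]; linarith only [hτ0]
  have hu : r ≤ T + 3 := by rw [hr_def]; linarith only [hτ3]
  have hc : ∀ t ∈ Icc T r, X t 2 ≤ ρ ^ 2 / K ^ 9 := by
    intro t ht
    rw [hr_def] at ht
    have h := hwin (t - T) (by linarith only [ht.1]) (by linarith only [ht.2])
    simpa using h
  have hhit' : r < T + 3 → X r 2 = ρ ^ 2 / K ^ 9 := fun h => by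
    rw [hr_def] at h ⊢
    exact hhit (by linarith only [h])
  -- the clock zero, the seed law, and `r < T + 3`
  obtain ⟨-, tz, ⟨htz1, htz2, hz⟩, htz_lt, hTw⟩ := knob_relight_zero hX h0 hK hε hεK hρ hhi hT
    hu hTr hθ1 hθ2 hbT hP hc hP0 hcT hhit'
  have hK5 : (0 : ℝ) < (K ^ 5)⁻¹ := by positivity
  have htzI : tz ∈ Icc T r := ⟨by linarith only [hTw, hK5], htz_lt.le⟩
  have hrI : r ∈ Icc T r := right_mem_Icc.2 hTr.le
  obtain ⟨B, hB⟩ := exists_clock_action hXf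
  have hseed := knob_cold_seed hX h0 hK hε hεK hρ hhi hT hu hθ.le hθ2 hbT hP hc hP2 hB htzI hz
    hTw
  have hr3 : r < T + 3 := by
    by_contra hge
    have hx : 3 - θ / (1 - P₀ - 8 / K ^ 9) ≤ r - tz := by
      linarith only [not_lt.1 hge, htz2, hu]
    linarith only [seed_forces_hit hsl1 hsl2 hθ2 hx, hseed]
  have hcr := hhit' hr3
  have hclock := (knob_cold_zero_action hX h0 hK hε hεK hρ hhi hT hu hθ.le hθ2 hbT hP hc hP2 hB
    htzI hz hrI).2.1 htz_lt.le
  exact ⟨tz, r, ⟨htz1, htz2, hz⟩, ⟨htz_lt, hr3⟩, hc, hcr,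
    knob_relight_lower hX h0 hK hε hεK hρ hhi hT hu hθ.le hθ2 hbT hP hc hP2 hcT htzI hz hcr,
    ⟨knob_cold_debt_relight hX h0 hK hε hεK hρ hhi hT hu hθ hθ2 hbT hP hc hP2 hL hℓ, hseed⟩,
    hclock⟩

end Summit.NavierStokesRegularity.FluidComputer.GateBudget
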